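import Literature.AnabelianGeometry.SemiGraphs.TemperedCompactPairSparse
import Literature.AnabelianGeometry.SemiGraphs.TemperedCompactPairExitsUnbounded
import Literature.AnabelianGeometry.SemiGraphs.SubdivisionGeodesicCoverNodes
import Literature.AnabelianGeometry.SemiGraphs.TreeGeodesics
import HarnessLib

/-!
# Two compact subgroups of `π₁^temp(𝒢)` at a graph with LOCALLY FINITE CORE (every vertex of infinite valence
# is joined to vertices of infinite valence by only finitely many closed edges): jointly compact or ANCHORED

Mochizuki, *Semi-graphs of anabelioids*, Publ. RIMS **42** (2006), §3, Theorem 3.7 (iv) p. 41: "The maximal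
compact subgroups of `π₁^temp(𝒢)` are precisely the verticial subgroups. The nontrivial intersections of two distinct
maximal compact subgroups of `π₁^temp(𝒢)` are precisely the edge-like subgroups." [cite: MochizukiSemiAnbd2006, Thm 3.7(iv) p.41].

PROOF-ONLY tool file (abc-iut cell, layer L3, row «T37iv-S2@FINITE-CORE-CLASS», file F11, seat abc-iut-L3-t8 gen 12;
no definition, no named fact).  Canonical chart of ANY countable `𝒢` with the hypotheses of Thm 3.7.  The *core
branches* at a vertex `u` are the branches `b` abutting to `u` whose edge has its other branch `b' ≠ b` at a vertex of
INFINITE valence; say `𝒢` has *locally finite core* (a hypothesis binder below, not a definition) if every vertex of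
infinite valence carries only FINITELY many core branches — every sparse graph (F9b: no core branch at all), every
graph with finitely many closed edges joining infinite-valence vertices (two infinite stars joined by one edge, …),
chains and trees of stars of finite core-degree.  The residual of the trichotomy (F1–F8 of abc-iut-L3-t8 gen 10/11) is
EMPTY for this class, WITHOUT pinning (F6) and without any distance bookkeeping:

* `SemiGraph.exists_opposite_branch_on_path` — on a path between vertex-points every branch-point comes with the
  OPPOSITE branch of its edge and the vertex that branch abuts to; `finite_branches_at_over_finite` — the branches of
  `𝒢_{∞,n}` at one vertex over a FINITE set of base branches are finitely many (finite fibres of `S n`, immersion);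
* ★★ `isCompact_or_anchored_of_finiteCore` — at a Thm-3.7 graph with locally finite core two compact subgroups
  `K₁`, `K₂` with `K₁ ⊓ K₂ ≠ 1` generate a compact subgroup or are ANCHORED: at a bridge-free level `M₀` without
  common fixed vertex the first interior vertex `z` of an extremal path between the fixed loci lies over a base vertex
  `u` of infinite valence (F8); the branches at `z` over a core branch of `u`, or along an edge towards a `K₁`- or
  `K₂`-fixed vertex, form a FINITE set `F` (subsingletons by F9a `fixed_neighbour_unique`); at every level `M ≥ M₀`
  the unfolded `K₁ ⊓ K₂`-fixed pair over `z` on the extremal path between the fixed loci (F8) has BOTH images in `F`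
  (the opposite branch of a member ends at a fixed end of the path, or at an interior vertex — over infinite valence
  by F8 — so that the member lies over a core branch): impossible by F7 `false_of_forall_unfolded_mem_finite`.
  Desk-check points: `F` is a set of branches of `𝒢_{∞,M₀}` at the ONE vertex `z`, the same for ALL `M ≥ M₀` (the
  vertices `w̃_M` all lie over `z` — exactly the hypothesis shape of F7); the end case uses that `z` is fixed by
  NEITHER subgroup at `M₀` (so the image of the member is THE branch at `z` towards the `K₁`-, resp. `K₂`-fixed
  locus, F9a `fixed_neighbour_unique`), which holds because `z` is the first interior vertex of an extremal path at a
  level WITHOUT bridge — the distance-one sub-case (a bridge at every level) is owned by F2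
  `TemperedCompactPairDistanceOne` (`exists_verticial_ge_of_forall_exists_bridge`, `exists_edgeLike_ge_inf_…`), the
  case of a common fixed vertex at every level by F1 `TemperedCompactPairBridgeRelative` (no bridge descent is used);
* ★★ the three ∀-pieces of (iv) OUTRIGHT for the class: `exists_verticial_ge_of_inf_verticial_ne_bot_of_finiteCore`
  (ANCHORED PACKAGE), `le_of_isMaximalCompactSubgroup_of_exotic_of_finiteCore` +
  `inf_eq_bot_of_isMaximalCompactSubgroup_of_exotic_of_ne_of_finiteCore` (ISOLATION),
  `verticial_of_isMaximalCompactSubgroup_of_ne_of_finiteCore` (SENTENCE 2); members: `finiteCore_of_sparse` (F9b's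
  class), `finiteCore_of_finite_core`.

So in the cell's ∀-countable typing any failure of sentence 2 of Thm 3.7 (iv) needs a base vertex of infinite
valence joined to vertices of infinite valence by INFINITELY many closed edges.  Honest framing: statements about
OUR typed `π₁^temp` at OUR typed carriers; print's Thm 3.7 concerns the graphs of [SemiAnbd] (the IUT chain's dual
graphs are finite); nothing here bears on [IUTchIII] Cor. 3.12; no side taken; typed ≠ proved.
-/
noncomputable section

open CategoryTheory Topology

namespace Literature.AnabelianGeometry.SemiGraphs

open SimpleGraph

universe u

namespace SemiGraph

variable {T : SemiGraph.{u}}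

/-- **The opposite branch on a path.**  On a path of the barycentric subdivision between two vertex-points, every
branch-point `b` comes with the OTHER branch `b' ≠ b` of its edge (the edge-point of `b` is interior; its two
neighbours on the path are the branch-points of that edge) and with the vertex `b'` abuts to.
[cite: MochizukiSemiAnbd2006, §1 pp.11-12] -/
theorem exists_opposite_branch_on_path {a c : T.Vertex} (p : T.subdivision.Walk (Sum.inl a) (Sum.inl c))
    (hp : p.IsPath) {b : T.Branch} (hb : (Sum.inr (Sum.inr b) : T.Node) ∈ p.support) :
    ∃ (b' : T.Branch) (t' : T.Vertex), b' ≠ b ∧ T.edgeOf b' = T.edgeOf b ∧ T.abuts b' = some t' ∧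
      (Sum.inr (Sum.inr b') : T.Node) ∈ p.support ∧ (Sum.inl t' : T.Node) ∈ p.support := by
  obtain ⟨he, -⟩ := edge_and_vertex_mem_support_of_branch_mem_support p hp hb (by simp)
  obtain ⟨n₁, n₂, hn₁, hn₂, hne, h₁, h₂⟩ := exists_adj_adj_of_mem_support p hp he (by simp) (by simp)
  obtain ⟨b₁, hb₁, rfl⟩ := (T.subdivision_adj_edge_iff (T.edgeOf b) n₁).mp h₁.symm
  obtain ⟨b₂, hb₂, rfl⟩ := (T.subdivision_adj_edge_iff (T.edgeOf b) n₂).mp h₂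
  have h12 : b₁ ≠ b₂ := fun h => hne (by rw [h])
  obtain ⟨b', hb'b, hb'e, hb'p⟩ : ∃ b' : T.Branch, b' ≠ b ∧ T.edgeOf b' = T.edgeOf b ∧
      (Sum.inr (Sum.inr b') : T.Node) ∈ p.support := by
    rcases eq_or_eq_of_edgeOf_eq h12 (hb₁.trans hb₂.symm) hb₁.symm with h | h
    · exact ⟨b₂, fun e => h12 (e.trans h).symm, hb₂, hn₂⟩
    · exact ⟨b₁, fun e => h12 (e.trans h), hb₁, hn₁⟩
  obtain ⟨-, t', ht', ht'p⟩ := edge_and_vertex_mem_support_of_branch_mem_support p hp hb'p (by simp)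
  exact ⟨b', t', hb'b, hb'e, ht', hb'p, ht'p⟩

end SemiGraph

namespace ProfiniteSemiGraph

variable {𝒢 : ProfiniteSemiGraph.{u}}

/-- **The branches of `𝒢_{∞,n}` at one vertex over a FINITE set of base branches are finitely many**: their images
in the finite level `𝔾_{S n}` lie in the finite union of the branch fibres of the finite covering `S n`, and
`𝒢_{∞,n} → 𝔾_{S n}` is injective on stars (an immersion). [cite: MochizukiSemiAnbd2006, Def 3.5(i) p.37] -/
theorem finite_branches_at_over_finite (h36 : 𝒢.Prop36Hypotheses) (n : ℕ)
    (z : ((𝒢.galoisLevelData h36).tree n).Vertex) (S : Set 𝒢.graph.Branch) (hS : S.Finite) :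
    {γ : ((𝒢.galoisLevelData h36).tree n).Branch | ((𝒢.galoisLevelData h36).tree n).abuts γ = some z ∧
      ((𝒢.galoisLevelData h36).treeProj n).branchMap γ ∈ S}.Finite := by
  classical
  let Dg := 𝒢.galoisLevelData h36
  let q : Dg.tree n ⟶ (Dg.S n).orbitGraph := Dg.treeQuot n
  have himg : (q.branchMap '' {γ : (Dg.tree n).Branch | (Dg.tree n).abuts γ = some z ∧
      (Dg.treeProj n).branchMap γ ∈ S}).Finite := by
    refine (hS.biUnion fun c _ =>
      (Dg.S n).finite_orbitGraph_branch_over (𝒢.galoisLevelData_isFinite h36 n) c).subset ?_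
    rintro _ ⟨γ, ⟨-, hγS⟩, rfl⟩
    simp only [Set.mem_iUnion, Set.mem_setOf_eq, exists_prop]
    exact ⟨(Dg.treeProj n).branchMap γ, hγS, rfl⟩
  refine Set.Finite.of_finite_image himg ?_
  rintro γ ⟨hγ, -⟩ γ' ⟨hγ', -⟩ h
  have hinj := Dg.treeQuot_isImmersion n z
  have h' : SemiGraph.Hom.starMap q z ⟨γ, hγ⟩ = SemiGraph.Hom.starMap q z ⟨γ', hγ'⟩ := Subtype.ext h
  exact congrArg Subtype.val (hinj h')

/-! ### ★★ Locally finite core: jointly compact or anchored -/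

section FiniteCore

variable (h37 : 𝒢.Thm37Hypotheses)

/-- ★★ **At a Thm-3.7 graph with LOCALLY FINITE CORE, two compact subgroups of `π₁^temp(𝒢)` meeting non-trivially
generate a compact subgroup or are ANCHORED** (`K₁`, `K₂` in verticial subgroups, `K₁ ⊓ K₂` in an edge-like
subgroup).  Locally finite core: every vertex of infinite valence carries only finitely many branches whose edge has
its other branch at a vertex of infinite valence.  F1 (a level without common fixed vertex), F2 (bridges at every
level: anchored), else F8 at a bridge-free level `M₀` (the vertex `z`, the finite set `F` of branches at `z`, the
unfolded `K₁ ⊓ K₂`-fixed pairs over `z` on the extremal paths of all deeper levels, both images in `F`) against F7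
`false_of_forall_unfolded_mem_finite` — see the file header. [cite: MochizukiSemiAnbd2006, Thm 3.7(iv) p.41] -/
theorem isCompact_or_anchored_of_finiteCore
    (hcore : ∀ v, ¬ {c | 𝒢.graph.abuts c = some v}.Finite → {b | 𝒢.graph.abuts b = some v ∧ ∃ b', b' ≠ b ∧
      𝒢.graph.edgeOf b' = 𝒢.graph.edgeOf b ∧ ∃ v', 𝒢.graph.abuts b' = some v' ∧ ¬ {c | 𝒢.graph.abuts c = some v'}.Finite}.Finite)
    (K₁ K₂ : Subgroup ((𝒢.galoisLevelData h37.toProp36Hypotheses).temperedPi h37.toProp36Hypotheses.isCountable))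
    (hK₁ : IsCompact (K₁ : Set ((𝒢.galoisLevelData h37.toProp36Hypotheses).temperedPi h37.toProp36Hypotheses.isCountable)))
    (hK₂ : IsCompact (K₂ : Set ((𝒢.galoisLevelData h37.toProp36Hypotheses).temperedPi h37.toProp36Hypotheses.isCountable))) (hne : K₁ ⊓ K₂ ≠ ⊥) :
    IsCompact ((K₁ ⊔ K₂).topologicalClosure : Set ((𝒢.galoisLevelData h37.toProp36Hypotheses).temperedPi h37.toProp36Hypotheses.isCountable)) ∨
    ((∃ (v : 𝒢.graph.Vertex) (H : Subgroup (𝒢.temperedPiChart h37.toProp36Hypotheses).G),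
        H ∈ verticialSubgroups (𝒢.temperedPiChart h37.toProp36Hypotheses) v ∧ K₁ ≤ H) ∧
      (∃ (v : 𝒢.graph.Vertex) (H : Subgroup (𝒢.temperedPiChart h37.toProp36Hypotheses).G),
        H ∈ verticialSubgroups (𝒢.temperedPiChart h37.toProp36Hypotheses) v ∧ K₂ ≤ H) ∧
      ∃ (e : 𝒢.graph.Edge) (L : Subgroup (𝒢.temperedPiChart h37.toProp36Hypotheses).G),
        L ∈ edgeLikeSubgroups (𝒢.temperedPiChart h37.toProp36Hypotheses) e ∧ K₁ ⊓ K₂ ≤ L) := by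
  classical
  have h36 := h37.toProp36Hypotheses
  let Dg := 𝒢.galoisLevelData h36
  have hc := h36.isCountable
  let D₀ : VerticialLevelData.{0} 𝒢 (𝒢.temperedPiChart h36) := verticialLevelData_temperedPiChart (h36 := h36)
  by_cases hK : IsCompact (((K₁ ⊔ K₂).topologicalClosure : Subgroup (Dg.temperedPi hc)) : Set (Dg.temperedPi hc))
  · exact Or.inl hK
  right
  -- some level `m` without a common fixed vertex (F1)
  obtain ⟨m, hm⟩ : ∃ m : ℕ, ∀ z : (Dg.tree m).Vertex,
      (∀ k ∈ K₁, (Dg.treeAct hc m k).hom.vertexMap z = z) → ¬ ∀ k ∈ K₂, (Dg.treeAct hc m k).hom.vertexMap z = z := by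
    by_contra h
    push Not at h
    exact hK (isCompact_topologicalClosure_sup_of_forall_exists_common_fixed_vertex h36 K₁ K₂
      fun m => by obtain ⟨z, hz₁, hz₂⟩ := h m; exact ⟨z, hz₁, hz₂⟩)
  by_cases hbr : ∀ M : ℕ, m ≤ M → ∃ (x y : (Dg.tree M).Vertex) (β₁ β₂ : (Dg.tree M).Branch), β₁ ≠ β₂ ∧
      (Dg.tree M).edgeOf β₁ = (Dg.tree M).edgeOf β₂ ∧ (Dg.tree M).abuts β₁ = some x ∧ (Dg.tree M).abuts β₂ = some y ∧
      (∀ k ∈ K₁, (Dg.treeAct hc M k).hom.vertexMap x = x) ∧ ∀ k ∈ K₂, (Dg.treeAct hc M k).hom.vertexMap y = y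
  · -- bridges at every level `M ≥ m`: the anchored regime (F2)
    obtain ⟨h₁, h₂⟩ := exists_verticial_ge_of_forall_exists_bridge h36 K₁ K₂ m hm hbr
    exact ⟨h₁, h₂, exists_edgeLike_ge_inf_of_forall_exists_bridge h36 K₁ K₂ m hm hbr⟩
  push Not at hbr
  obtain ⟨M₀, hmM₀, hnobr₀⟩ := hbr
  have hno₀ : ∀ z : (Dg.tree M₀).Vertex, (∀ k ∈ K₁, (Dg.treeAct hc M₀ k).hom.vertexMap z = z) →
      ¬ ∀ k ∈ K₂, (Dg.treeAct hc M₀ k).hom.vertexMap z = z :=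
    fun z hz => forall_not_common_fixed_of_le h36 K₁ K₂ hmM₀ hm z hz
  have hpushV : ∀ (K : Subgroup (Dg.temperedPi hc)) {M M' : ℕ} (h : M ≤ M') (w : (Dg.tree M').Vertex),
      (∀ k ∈ K, (Dg.treeAct hc M' k).hom.vertexMap w = w) →
      ∀ k ∈ K, (Dg.treeAct hc M k).hom.vertexMap ((Dg.treeTrans h).vertexMap w) = (Dg.treeTrans h).vertexMap w := by
    intro K M M' h w hw k hk
    have e : (Dg.treeTrans h).vertexMap ((Dg.treeAct hc M' k).hom.vertexMap w) =
        (Dg.treeAct hc M k).hom.vertexMap ((Dg.treeTrans h).vertexMap w) := D₀.trans_act_vertexMap h k w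
    rw [hw k hk] at e
    exact e.symm
  haveI : T2Space (Dg.temperedPi hc) := Dg.t2Space_temperedPi hc
  have hCc : IsCompact ((K₁ ⊓ K₂ : Subgroup _) : Set (Dg.temperedPi hc)) := by
    rw [Subgroup.coe_inf]; exact hK₁.inter_right hK₂.isClosed
  -- an extremal path `δ : x ⟶ y` between the fixed loci of level `M₀`, with first step `x – z`
  let T := Dg.tree M₀
  have hT := (Dg.isTree_tree M₀).isTree
  let A : Set T.Vertex := {a | ∀ k ∈ K₁, (Dg.treeAct hc M₀ k).hom.vertexMap a = a}
  let B : Set T.Vertex := {b | ∀ k ∈ K₂, (Dg.treeAct hc M₀ k).hom.vertexMap b = b}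
  obtain ⟨a₀, ha₀⟩ := D₀.exists_forall_mem_fixed_vertex_of_isCompact K₁ hK₁ M₀
  obtain ⟨b₀, hb₀⟩ := D₀.exists_forall_mem_fixed_vertex_of_isCompact K₂ hK₂ M₀
  obtain ⟨γ₀, hγ₀, -⟩ := (hT.connected (Sum.inl a₀ : T.Node) (Sum.inl b₀)).exists_path_of_dist
  obtain ⟨x, y, δ, hxA, hyB, hδ, -, hext⟩ := SemiGraph.exists_extremal_subpath A B γ₀.length γ₀ hγ₀ rfl ha₀ hb₀
  have hxy : x ≠ y := fun h => hno₀ x hxA (h ▸ hyB)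
  obtain ⟨β₁, β₁', z, δ₁, h11, he₁, hβ₁x, hβ₁'z, -, hsupp₁⟩ := SemiGraph.exists_first_step δ rfl rfl hδ hxy
  have hzδ : (Sum.inl z : T.Node) ∈ δ.support := by rw [hsupp₁]; exact List.mem_append_right _ δ₁.start_mem_support
  have hxδ₁ : (Sum.inl x : T.Node) ∉ δ₁.support := by
    have hnd : δ.support.Nodup := (Walk.isPath_def δ).mp hδ
    rw [hsupp₁] at hnd
    exact fun h => (List.disjoint_of_nodup_append hnd) (by simp) h
  have hzx : z ≠ x := fun h => hxδ₁ (h ▸ δ₁.start_mem_support)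
  have hzA : z ∉ A := fun h => hzx ((hext z hzδ).1 h)
  have hzy : z ≠ y := by
    intro h; subst h
    exact hnobr₀ x z β₁ β₁' h11 he₁ hβ₁x hβ₁'z hxA |>.elim fun k hk => hk.2 (hyB k hk.1)
  have hzB : z ∉ B := fun h => hzy ((hext z hzδ).2 h)
  -- the base vertex `u₀` under `z` has infinite valence (F8), so it carries finitely many core branches
  have hzinf : ¬ {b : 𝒢.graph.Branch | 𝒢.graph.abuts b = some ((Dg.treeProj M₀).vertexMap z)}.Finite :=
    not_finite_star_of_mem_path h37 K₁ K₂ hK₁ hK₂ hne M₀ hxA hyB δ hδ z hzδ hzA hzB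
  let u₀ : 𝒢.graph.Vertex := (Dg.treeProj M₀).vertexMap z
  let Core : Set 𝒢.graph.Branch := {b | 𝒢.graph.abuts b = some u₀ ∧ ∃ b' : 𝒢.graph.Branch, b' ≠ b ∧
    𝒢.graph.edgeOf b' = 𝒢.graph.edgeOf b ∧ ∃ v' : 𝒢.graph.Vertex, 𝒢.graph.abuts b' = some v' ∧
    ¬ {c : 𝒢.graph.Branch | 𝒢.graph.abuts c = some v'}.Finite}
  have hCore : Core.Finite := hcore u₀ hzinf
  -- the finite set `F` of branches at `z`: over a core branch, or along an edge towards a fixed vertex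
  let FA : Set T.Branch := {γ | T.abuts γ = some z ∧ ∃ (γ' : T.Branch) (x' : T.Vertex), γ' ≠ γ ∧
    T.edgeOf γ' = T.edgeOf γ ∧ T.abuts γ' = some x' ∧ x' ∈ A}
  let FB : Set T.Branch := {γ | T.abuts γ = some z ∧ ∃ (γ' : T.Branch) (y' : T.Vertex), γ' ≠ γ ∧
    T.edgeOf γ' = T.edgeOf γ ∧ T.abuts γ' = some y' ∧ y' ∈ B}
  let FC : Set T.Branch := {γ | T.abuts γ = some z ∧ (Dg.treeProj M₀).branchMap γ ∈ Core}
  have hFA : FA.Finite := by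
    refine Set.Subsingleton.finite ?_
    rintro γ₁ ⟨hγ₁, γ₁', x₁, hne₁, he₁', hx₁, hx₁A⟩ γ₂ ⟨hγ₂, γ₂', x₂, hne₂, he₂', hx₂, hx₂A⟩
    exact (fixed_neighbour_unique h36 M₀ K₁ hne₁ he₁' hx₁ hγ₁ hne₂ he₂' hx₂ hγ₂ hx₁A hx₂A hzA).2.2
  have hFB : FB.Finite := by
    refine Set.Subsingleton.finite ?_
    rintro γ₁ ⟨hγ₁, γ₁', y₁, hne₁, he₁', hy₁, hy₁B⟩ γ₂ ⟨hγ₂, γ₂', y₂, hne₂, he₂', hy₂, hy₂B⟩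
    exact (fixed_neighbour_unique h36 M₀ K₂ hne₁ he₁' hy₁ hγ₁ hne₂ he₂' hy₂ hγ₂ hy₁B hy₂B hzB).2.2
  have hFC : FC.Finite := finite_branches_at_over_finite h36 M₀ z Core hCore
  let F : Set T.Branch := FC ∪ (FA ∪ FB)
  have hF : F.Finite := hFC.union (hFA.union hFB)
  have hoverB : ∀ {M : ℕ} (hM : M₀ ≤ M) (b : (Dg.tree M).Branch),
      (Dg.treeProj M₀).branchMap ((Dg.treeTrans hM).branchMap b) = (Dg.treeProj M).branchMap b := fun hM b => by
    simpa only [SemiGraph.comp_branchMap, Function.comp_apply] using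
      congrArg (fun φ => SemiGraph.Hom.branchMap φ b) (Dg.treeTrans_over hM)
  have hoverV : ∀ {M : ℕ} (hM : M₀ ≤ M) (w : (Dg.tree M).Vertex),
      (Dg.treeProj M₀).vertexMap ((Dg.treeTrans hM).vertexMap w) = (Dg.treeProj M).vertexMap w := fun hM w => by
    simpa only [SemiGraph.comp_vertexMap, Function.comp_apply] using
      congrArg (fun φ => SemiGraph.Hom.vertexMap φ w) (Dg.treeTrans_over hM)
  -- every level `M ≥ M₀` carries an unfolded `K₁ ⊓ K₂`-fixed pair over `z` with both images in `F`: impossible (F7)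
  refine (false_of_forall_unfolded_mem_finite h37 (K₁ ⊓ K₂) hCc hne M₀ z F hF fun M hM => ?_).elim
  let TM := Dg.tree M
  have hTM := (Dg.isTree_tree M).isTree
  let AM : Set TM.Vertex := {a | ∀ k ∈ K₁, (Dg.treeAct hc M k).hom.vertexMap a = a}
  let BM : Set TM.Vertex := {b | ∀ k ∈ K₂, (Dg.treeAct hc M k).hom.vertexMap b = b}
  obtain ⟨a₁, ha₁⟩ := D₀.exists_forall_mem_fixed_vertex_of_isCompact K₁ hK₁ M
  obtain ⟨b₁, hb₁⟩ := D₀.exists_forall_mem_fixed_vertex_of_isCompact K₂ hK₂ M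
  obtain ⟨γ₁, hγ₁, -⟩ := (hTM.connected (Sum.inl a₁ : TM.Node) (Sum.inl b₁)).exists_path_of_dist
  obtain ⟨xM, yM, γ, hxM, hyM, hγ, -, hextM⟩ :=
    SemiGraph.exists_extremal_subpath AM BM γ₁.length γ₁ hγ₁ rfl ha₁ hb₁
  obtain ⟨w, β, β', hw, hβ, hβ', hβw, hβ'w, hwz, hββ'⟩ :=
    exists_unfolded_crossing_of_mem_path h36 K₁ K₂ M₀ hxA hyB δ hδ z hzδ hzA hzB M hM hxM hyM γ
  let π := Dg.treeTrans hM
  have hmemF : ∀ b : TM.Branch, (Sum.inr (Sum.inr b) : TM.Node) ∈ γ.support → TM.abuts b = some w →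
      π.branchMap b ∈ F := by
    intro b hb hbw
    have hπb : T.abuts (π.branchMap b) = some z := by rw [π.abuts_branchMap b w hbw, hwz]
    obtain ⟨b'', t'', hb''b, hb''e, hb''t, hb''γ, ht''γ⟩ := SemiGraph.exists_opposite_branch_on_path γ hγ hb
    have hπne : π.branchMap b'' ≠ π.branchMap b := fun h => hb''b (π.branchMap_injOn _ _ hb''e h)
    have hπe : T.edgeOf (π.branchMap b'') = T.edgeOf (π.branchMap b) := by
      rw [π.edgeOf_branchMap, π.edgeOf_branchMap, hb''e]
    have hπt : T.abuts (π.branchMap b'') = some (π.vertexMap t'') := π.abuts_branchMap b'' t'' hb''t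
    by_cases htx : t'' = xM
    · refine Or.inr (Or.inl ⟨hπb, π.branchMap b'', π.vertexMap t'', hπne, hπe, hπt, ?_⟩)
      rw [htx]
      exact hpushV K₁ hM xM hxM
    by_cases hty : t'' = yM
    · refine Or.inr (Or.inr ⟨hπb, π.branchMap b'', π.vertexMap t'', hπne, hπe, hπt, ?_⟩)
      rw [hty]
      exact hpushV K₂ hM yM hyM
    -- the opposite branch ends at an interior vertex of `γ`: over infinite valence (F8), so `b` is over a core branch
    have htA : t'' ∉ AM := fun h => htx ((hextM t'' ht''γ).1 h)
    have htB : t'' ∉ BM := fun h => hty ((hextM t'' ht''γ).2 h)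
    have htinf : ¬ {c : 𝒢.graph.Branch | 𝒢.graph.abuts c = some ((Dg.treeProj M).vertexMap t'')}.Finite :=
      not_finite_star_of_mem_path h37 K₁ K₂ hK₁ hK₂ hne M hxM hyM γ hγ t'' ht''γ htA htB
    refine Or.inl ⟨hπb, ?_⟩
    rw [hoverB hM b]
    have hbu : 𝒢.graph.abuts ((Dg.treeProj M).branchMap b) = some u₀ := by
      rw [(Dg.treeProj M).abuts_branchMap b w hbw, ← hoverV hM w, hwz]
    refine ⟨hbu, (Dg.treeProj M).branchMap b'', fun h => hb''b ((Dg.treeProj M).branchMap_injOn _ _ hb''e h), ?_,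
      (Dg.treeProj M).vertexMap t'', (Dg.treeProj M).abuts_branchMap b'' t'' hb''t, htinf⟩
    rw [(Dg.treeProj M).edgeOf_branchMap, (Dg.treeProj M).edgeOf_branchMap, hb''e]
  refine ⟨w, β, β', hβw, hβ'w, hwz, hββ', hmemF β hβ hβw, hmemF β' hβ' hβ'w, fun g hg => ?_⟩
  obtain ⟨hg₁, hg₂⟩ := Subgroup.mem_inf.mp hg
  obtain ⟨hfixV, hfixB⟩ := fixes_of_mem_support_path h36 M g (hxM g hg₁) (hyM g hg₂) γ hγ
  exact ⟨hfixV w hw, hfixB β hβ, hfixB β' hβ'⟩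

/-! ### ★★ The three ∀-pieces of Thm 3.7 (iv) OUTRIGHT at graphs with locally finite core -/

/-- ★★ **ANCHORED PACKAGE at a graph with locally finite core**: a compact subgroup `K` of `π₁^temp(𝒢)` meeting a
VERTICIAL subgroup `H` non-trivially lies in SOME verticial subgroup (if `(H ⊔ K)‾` is compact it contains the
maximal compact `H`, abc-iut-w6-d064's `eq_of_verticial_le_compact`, so `K ≤ H`; otherwise
`isCompact_or_anchored_of_finiteCore`). [cite: MochizukiSemiAnbd2006, Thm 3.7(iv) p.41] -/
theorem exists_verticial_ge_of_inf_verticial_ne_bot_of_finiteCore {v : 𝒢.graph.Vertex}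
    (hcore : ∀ v, ¬ {c | 𝒢.graph.abuts c = some v}.Finite → {b | 𝒢.graph.abuts b = some v ∧ ∃ b', b' ≠ b ∧
      𝒢.graph.edgeOf b' = 𝒢.graph.edgeOf b ∧ ∃ v', 𝒢.graph.abuts b' = some v' ∧ ¬ {c | 𝒢.graph.abuts c = some v'}.Finite}.Finite)
    (H K : Subgroup ((𝒢.galoisLevelData h37.toProp36Hypotheses).temperedPi h37.toProp36Hypotheses.isCountable))
    (hH : H ∈ verticialSubgroups (𝒢.temperedPiChart h37.toProp36Hypotheses) v)
    (hK : IsCompact (K : Set ((𝒢.galoisLevelData h37.toProp36Hypotheses).temperedPi h37.toProp36Hypotheses.isCountable))) (hne : H ⊓ K ≠ ⊥) :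
    ∃ (w : 𝒢.graph.Vertex) (H' : Subgroup (𝒢.temperedPiChart h37.toProp36Hypotheses).G),
      H' ∈ verticialSubgroups (𝒢.temperedPiChart h37.toProp36Hypotheses) w ∧ K ≤ H' := by
  have h36 := h37.toProp36Hypotheses
  have hHc : IsCompact (H : Set ((𝒢.galoisLevelData h36).temperedPi h36.isCountable)) :=
    isCompact_of_mem_verticialSubgroups (𝒢.temperedPiChart h36) hH
  rcases isCompact_or_anchored_of_finiteCore h37 hcore H K hHc hK hne with hcpt | ⟨-, hK', -⟩
  · have hle : H ≤ (H ⊔ K).topologicalClosure := le_sup_left.trans (Subgroup.le_topologicalClosure _)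
    have heq := eq_of_verticial_le_compact h37 (𝒢.temperedPiChart h36) hH hcpt hle
    exact ⟨v, H, hH, (le_sup_right.trans (Subgroup.le_topologicalClosure _)).trans heq.le⟩
  · exact hK'

/-- ★★ **ISOLATION at a graph with locally finite core**: a compact subgroup `K` meeting an EXOTIC maximal compact
subgroup `K₀` (one lying in no verticial subgroup) non-trivially lies in `K₀`. [cite: MochizukiSemiAnbd2006, Thm 3.7(iv) p.41] -/
theorem le_of_isMaximalCompactSubgroup_of_exotic_of_finiteCore
    (hcore : ∀ v, ¬ {c | 𝒢.graph.abuts c = some v}.Finite → {b | 𝒢.graph.abuts b = some v ∧ ∃ b', b' ≠ b ∧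
      𝒢.graph.edgeOf b' = 𝒢.graph.edgeOf b ∧ ∃ v', 𝒢.graph.abuts b' = some v' ∧ ¬ {c | 𝒢.graph.abuts c = some v'}.Finite}.Finite)
    (K K₀ : Subgroup ((𝒢.galoisLevelData h37.toProp36Hypotheses).temperedPi h37.toProp36Hypotheses.isCountable))
    (hK : IsCompact (K : Set ((𝒢.galoisLevelData h37.toProp36Hypotheses).temperedPi h37.toProp36Hypotheses.isCountable))) (hK₀ : IsMaximalCompactSubgroup K₀)
    (hK₀ex : ∀ (w : 𝒢.graph.Vertex) (H' : Subgroup (𝒢.temperedPiChart h37.toProp36Hypotheses).G),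
      H' ∈ verticialSubgroups (𝒢.temperedPiChart h37.toProp36Hypotheses) w → ¬ K₀ ≤ H')
    (hne : K ⊓ K₀ ≠ ⊥) : K ≤ K₀ := by
  rcases isCompact_or_anchored_of_finiteCore h37 hcore K K₀ hK hK₀.1 hne with hcpt | ⟨-, ⟨w, H', hH', hK₀H'⟩, -⟩
  · have hle₀ : K₀ ≤ (K ⊔ K₀).topologicalClosure := le_sup_right.trans (Subgroup.le_topologicalClosure _)
    have heq := hK₀.2 _ hcpt hle₀
    exact (le_sup_left.trans (Subgroup.le_topologicalClosure _)).trans heq.le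
  · exact absurd hK₀H' (hK₀ex w H' hH')

/-- ★★ **An exotic maximal compact subgroup of a graph with locally finite core meets every OTHER maximal compact
subgroup trivially.** [cite: MochizukiSemiAnbd2006, Thm 3.7(iv) p.41] -/
theorem inf_eq_bot_of_isMaximalCompactSubgroup_of_exotic_of_ne_of_finiteCore
    (hcore : ∀ v, ¬ {c | 𝒢.graph.abuts c = some v}.Finite → {b | 𝒢.graph.abuts b = some v ∧ ∃ b', b' ≠ b ∧
      𝒢.graph.edgeOf b' = 𝒢.graph.edgeOf b ∧ ∃ v', 𝒢.graph.abuts b' = some v' ∧ ¬ {c | 𝒢.graph.abuts c = some v'}.Finite}.Finite)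
    (K K₀ : Subgroup ((𝒢.galoisLevelData h37.toProp36Hypotheses).temperedPi h37.toProp36Hypotheses.isCountable))
    (hK : IsMaximalCompactSubgroup K) (hK₀ : IsMaximalCompactSubgroup K₀)
    (hK₀ex : ∀ (w : 𝒢.graph.Vertex) (H' : Subgroup (𝒢.temperedPiChart h37.toProp36Hypotheses).G),
      H' ∈ verticialSubgroups (𝒢.temperedPiChart h37.toProp36Hypotheses) w → ¬ K₀ ≤ H')
    (hKK₀ : K ≠ K₀) : K ⊓ K₀ = ⊥ := by
  by_contra hne
  have hle : K ≤ K₀ :=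
    le_of_isMaximalCompactSubgroup_of_exotic_of_finiteCore h37 hcore K K₀ hK.1 hK₀ hK₀ex hne
  exact hKK₀ (hK.2 K₀ hK₀.1 hle).symm

/-- ★★ **THM 3.7 (iv), SECOND SENTENCE, at a graph with locally finite core**: two DISTINCT maximal compact subgroups
of `π₁^temp(𝒢)` meeting non-trivially are BOTH VERTICIAL and their intersection lies in an EDGE-LIKE subgroup.
[cite: MochizukiSemiAnbd2006, Thm 3.7(iv) p.41] -/
theorem verticial_of_isMaximalCompactSubgroup_of_ne_of_finiteCore
    (hcore : ∀ v, ¬ {c | 𝒢.graph.abuts c = some v}.Finite → {b | 𝒢.graph.abuts b = some v ∧ ∃ b', b' ≠ b ∧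
      𝒢.graph.edgeOf b' = 𝒢.graph.edgeOf b ∧ ∃ v', 𝒢.graph.abuts b' = some v' ∧ ¬ {c | 𝒢.graph.abuts c = some v'}.Finite}.Finite)
    (K₁ K₂ : Subgroup ((𝒢.galoisLevelData h37.toProp36Hypotheses).temperedPi h37.toProp36Hypotheses.isCountable))
    (hK₁ : IsMaximalCompactSubgroup K₁) (hK₂ : IsMaximalCompactSubgroup K₂) (hne₁₂ : K₁ ≠ K₂)
    (hne : K₁ ⊓ K₂ ≠ ⊥) :
    (∃ v : 𝒢.graph.Vertex, K₁ ∈ verticialSubgroups (𝒢.temperedPiChart h37.toProp36Hypotheses) v) ∧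
      (∃ v : 𝒢.graph.Vertex, K₂ ∈ verticialSubgroups (𝒢.temperedPiChart h37.toProp36Hypotheses) v) ∧
      ∃ (e : 𝒢.graph.Edge) (L : Subgroup (𝒢.temperedPiChart h37.toProp36Hypotheses).G),
        L ∈ edgeLikeSubgroups (𝒢.temperedPiChart h37.toProp36Hypotheses) e ∧ K₁ ⊓ K₂ ≤ L := by
  rcases isCompact_or_anchored_of_finiteCore h37 hcore K₁ K₂ hK₁.1 hK₂.1 hne with
    hcpt | ⟨⟨v₁, H₁, hH₁, hK₁H₁⟩, ⟨v₂, H₂, hH₂, hK₂H₂⟩, hedge⟩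
  · have h₁ := hK₁.2 _ hcpt (le_sup_left.trans (Subgroup.le_topologicalClosure _))
    have h₂ := hK₂.2 _ hcpt (le_sup_right.trans (Subgroup.le_topologicalClosure _))
    exact absurd (h₁.symm.trans h₂) hne₁₂
  · have h₁ : K₁ = H₁ := le_antisymm hK₁H₁ ((hK₁.2 H₁ (isCompact_of_mem_verticialSubgroups _ hH₁) hK₁H₁).le)
    have h₂ : K₂ = H₂ := le_antisymm hK₂H₂ ((hK₂.2 H₂ (isCompact_of_mem_verticialSubgroups _ hH₂) hK₂H₂).le)
    exact ⟨⟨v₁, h₁ ▸ hH₁⟩, ⟨v₂, h₂ ▸ hH₂⟩, hedge⟩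

end FiniteCore

/-- **Sparse graphs have locally finite core** (indeed no core branch at a vertex of infinite valence): F9b's
`isCompact_or_anchored_of_sparse` is the special case of `isCompact_or_anchored_of_finiteCore`.
[cite: MochizukiSemiAnbd2006, Thm 3.7(iv) p.41] -/
theorem finiteCore_of_sparse
    (hsp : ∀ (b b' : 𝒢.graph.Branch) (v v' : 𝒢.graph.Vertex), b ≠ b' → 𝒢.graph.edgeOf b = 𝒢.graph.edgeOf b' →
      𝒢.graph.abuts b = some v → 𝒢.graph.abuts b' = some v' →
      {c : 𝒢.graph.Branch | 𝒢.graph.abuts c = some v}.Finite ∨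
        {c : 𝒢.graph.Branch | 𝒢.graph.abuts c = some v'}.Finite) :
    ∀ v : 𝒢.graph.Vertex, ¬ {c : 𝒢.graph.Branch | 𝒢.graph.abuts c = some v}.Finite →
      {b : 𝒢.graph.Branch | 𝒢.graph.abuts b = some v ∧ ∃ b' : 𝒢.graph.Branch, b' ≠ b ∧
        𝒢.graph.edgeOf b' = 𝒢.graph.edgeOf b ∧ ∃ v' : 𝒢.graph.Vertex, 𝒢.graph.abuts b' = some v' ∧
        ¬ {c : 𝒢.graph.Branch | 𝒢.graph.abuts c = some v'}.Finite}.Finite := by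
  intro v hv
  refine Set.finite_empty.subset ?_
  rintro b ⟨hb, b', hb'b, he, v', hb', hv'⟩
  rcases hsp b' b v' v hb'b he hb' hb with h | h
  · exact absurd h hv'
  · exact absurd h hv

/-- **Finitely many core branches overall suffice** (e.g. two vertices of infinite valence joined by finitely many
closed edges, all other edges ending at vertices of finite valence). [cite: MochizukiSemiAnbd2006, Thm 3.7(iv) p.41] -/
theorem finiteCore_of_finite_core
    (hfin : {b : 𝒢.graph.Branch | (∃ v : 𝒢.graph.Vertex, 𝒢.graph.abuts b = some v ∧
        ¬ {c : 𝒢.graph.Branch | 𝒢.graph.abuts c = some v}.Finite) ∧ ∃ b' : 𝒢.graph.Branch, b' ≠ b ∧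
        𝒢.graph.edgeOf b' = 𝒢.graph.edgeOf b ∧ ∃ v' : 𝒢.graph.Vertex, 𝒢.graph.abuts b' = some v' ∧
        ¬ {c : 𝒢.graph.Branch | 𝒢.graph.abuts c = some v'}.Finite}.Finite) :
    ∀ v : 𝒢.graph.Vertex, ¬ {c : 𝒢.graph.Branch | 𝒢.graph.abuts c = some v}.Finite →
      {b : 𝒢.graph.Branch | 𝒢.graph.abuts b = some v ∧ ∃ b' : 𝒢.graph.Branch, b' ≠ b ∧
        𝒢.graph.edgeOf b' = 𝒢.graph.edgeOf b ∧ ∃ v' : 𝒢.graph.Vertex, 𝒢.graph.abuts b' = some v' ∧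
        ¬ {c : 𝒢.graph.Branch | 𝒢.graph.abuts c = some v'}.Finite}.Finite := by
  intro v hv
  refine hfin.subset ?_
  rintro b ⟨hb, hb'⟩
  exact ⟨⟨v, hb, hv⟩, hb'⟩

end ProfiniteSemiGraph

end Literature.AnabelianGeometry.SemiGraphs

end
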